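import Summits.CriticalPhenomena.PercolationContinuityZ3.Theorems.PercNearOneGluingAdditiveGluingSigmaRecursion
import Literature.Probability.Percolation.KozmaNitzanPreFKG
import HarnessLib

/-!
# `NoHeavyLowerTail` (stmt-CriticalPhenomena-4575) — Kozma–Nitzan Question 9 for a glued block that is
# AT LEAST AS RELIABLE AS THE ANCHOR (a certificate leaf with no port structure)

Support file (lemma factory `prim-lf-1` gen 7, coupling / BK–Harris technique; `--supports stmt-CriticalPhenomena-4575`).
No definitions, no named facts, no sorries.

Setting (`Fin n`, weights `w`): a finite vertex set `O` (the "block": an observer `o` glued to the hubs / Steiner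
pocket it reaches), `μ_{glue_O w}` = percolation with every non-loop pair inside `O` given weight `1` (the block
contracted), relays `A`, target `b`, anchor relay `a`.  The inequality of Kozma–Nitzan's Question 9 / (41) for the
block (memo `prim-hp-1/HULLPORT-COUPLING.md` §48, tree `BlockQ9.blockThm4_witness`, `BlockQ9.blockQ9_step`) is
`Q9(w, a) :≡ μ_{glue_O w}(a ↔ b, O ↔ A) ≤ μ_{glue_O w}(O ↔ b)`.

* `blockQ9_of_reliableBlock_slack` — for ANY `O ∋ o₀`, `A`, `a`, `b` and `δ ≥ 0`: if
  `μ_{glue_O w}(a ↔ b) ≤ μ_{glue_O w}(o₀ ↔ b) + δ` then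
  `μ_{glue_O w}(a ↔ b, O ↔ A) ≤ μ_{glue_O w}(O ↔ b) + δ · μ_{glue_O w}(O ↔ A)`.
  No one-layer / disjointness / port hypothesis is needed.  Proof: under the glued weights the block is one open
  cluster almost surely (`sigmaRec_conull`), so `{O ↔ A} = {C(o₀) meets A}` is an increasing event read off the open
  edge cluster of `o₀`, and Kozma–Nitzan's Lemma 3(i) (`KozmaNitzan2024_lemma3_i`, BHK Thms 1.3/1.4 + Harris) with
  `a₁ = a`, `a₂ = o₀`, `Q = {O ↔ A}` is exactly the display.
* `blockQ9_of_reliableBlock` — the case `δ = 0`: **a block that is at least as connected to `b` as the anchor satisfies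
  `Q9(w, a)`**.  This is a second certificate LEAF for the block-Q9 peeling scheme of `…BlockQ9Certificate.lean`, next to
  Theorem 4 (`blockThm4_witness`, anchor dominated by every port in the block-DELETED graph): here the comparison is
  with the GLUED block carrying its random port pairs, so it covers blocks whose ports are individually weak but jointly
  strong (exact census of the lemma-factory memo FROM-prim-lf-1-gen7.md §3: 5.4 % of random depth-two pieces, all but
  0.19 % of those not covered by Theorem 4).
* `blockGluing_of_reliableBlock` — the additive-gluing reading:
  `μ_{glue_O w}(O ↔ A) − μ_{glue_O w}(O ↔ b) ≤ μ_{glue_O w}(O ↔ A, a ↮ b) + δ · μ_{glue_O w}(O ↔ A)`.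

With `O = {o}` (nothing glued) these are statements about an ordinary observer `o`: an observer at least as connected
to `b` as some relay `a` satisfies (41) with that relay, hence glues additively with defect `≤ μ(a ↮ b)`.
-/

namespace Summit.CriticalPhenomena.PercolationContinuityZ3.Theorems

open MeasureTheory Set
open Literature.Probability.LatticeModels
open Literature.Probability.Percolation

noncomputable section
open Classical

namespace BlockQ9

variable {n : ℕ}

/-- Under the glued weights of `O`, almost surely every non-loop pair inside `O` is open. [folklore] -/
theorem glue_conull (w : Sym2 (Fin n) → unitInterval) (O : Finset (Fin n)) :
    prodBernoulli (fun e : Sym2 (Fin n) => if (∀ x ∈ e, x ∈ O) ∧ ¬ e.IsDiag then 1 else w e)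
      {ω : BondConfig (Fin n) | ∀ o ∈ O, ∀ o' ∈ O, o ≠ o' → s(o, o') ∈ ω}ᶜ = 0 := by
  refine sigmaRec_conull _ _ fun ω hω => ?_
  simp only [mem_setOf_eq, not_forall] at hω
  obtain ⟨o, ho, o', ho', hne, hclosed⟩ := hω
  refine ⟨s(o, o'), ?_, hclosed⟩
  rw [if_pos ⟨fun x hx => by rcases Sym2.mem_iff.1 hx with rfl | rfl <;> assumption,
    by rw [Sym2.mk_isDiag_iff]; exact hne⟩]

/-- On the almost-sure event of `glue_conull`, every vertex of the block is joined to `o₀ ∈ O`. [folklore] -/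
theorem reachable_of_mem_block {O : Finset (Fin n)} {ω : BondConfig (Fin n)}
    (hω : ω ∈ {ω : BondConfig (Fin n) | ∀ o ∈ O, ∀ o' ∈ O, o ≠ o' → s(o, o') ∈ ω}) {o₀ o : Fin n}
    (ho₀ : o₀ ∈ O) (ho : o ∈ O) : (openGraph ω).Reachable o₀ o := by
  by_cases h : o₀ = o
  · subst h; exact SimpleGraph.Reachable.refl _
  · refine SimpleGraph.Adj.reachable ?_
    rw [openGraph_adj]
    exact ⟨hω o₀ ho₀ o ho h, h⟩

/-- **Question 9 for a glued block at least as reliable as the anchor, with slack.**  For any finset `O ∋ o₀`, any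
`A`, `a`, `b` and `δ ≥ 0`: if `μ_{glue_O w}(a ↔ b) ≤ μ_{glue_O w}(o₀ ↔ b) + δ` then
`μ_{glue_O w}(a ↔ b, O ↔ A) ≤ μ_{glue_O w}(O ↔ b) + δ · μ_{glue_O w}(O ↔ A)`
(Kozma–Nitzan Lemma 3(i) with `a₂ = o₀` and the increasing `C(o₀)`-measurable event `{O ↔ A}`). [this work; cite: KozmaNitzan2024, Lemma 3(i) (pp. 6–7)] -/
theorem blockQ9_of_reliableBlock_slack (w : Sym2 (Fin n) → unitInterval) (O A : Finset (Fin n)) (a b o₀ : Fin n)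
    (ho₀ : o₀ ∈ O) {δ : ℝ} (hδ : 0 ≤ δ)
    (hdom : (prodBernoulli (fun e : Sym2 (Fin n) => if (∀ x ∈ e, x ∈ O) ∧ ¬ e.IsDiag then 1 else w e)).real
        (openConn a b) ≤
      (prodBernoulli (fun e : Sym2 (Fin n) => if (∀ x ∈ e, x ∈ O) ∧ ¬ e.IsDiag then 1 else w e)).real
        (openConn o₀ b) + δ) :
    (prodBernoulli (fun e : Sym2 (Fin n) => if (∀ x ∈ e, x ∈ O) ∧ ¬ e.IsDiag then 1 else w e)).real
        (openConn a b ∩ ⋃ o ∈ O, ⋃ x ∈ A, openConn o x) ≤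
      (prodBernoulli (fun e : Sym2 (Fin n) => if (∀ x ∈ e, x ∈ O) ∧ ¬ e.IsDiag then 1 else w e)).real
        (⋃ o ∈ O, openConn o b) +
      δ * (prodBernoulli (fun e : Sym2 (Fin n) => if (∀ x ∈ e, x ∈ O) ∧ ¬ e.IsDiag then 1 else w e)).real
        (⋃ o ∈ O, ⋃ x ∈ A, openConn o x) := by
  classical
  set g : Sym2 (Fin n) → unitInterval := fun e => if (∀ x ∈ e, x ∈ O) ∧ ¬ e.IsDiag then 1 else w e with hg
  set K : Set (BondConfig (Fin n)) := {ω | ∀ o ∈ O, ∀ o' ∈ O, o ≠ o' → s(o, o') ∈ ω} with hK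
  have hKc : prodBernoulli g Kᶜ = 0 := glue_conull w O
  -- the increasing `C(o₀)`-family "the open edge cluster of `o₀` sees a vertex of `A`"
  set 𝒬 : Set (Set (Sym2 (Fin n))) := ⋃ x ∈ A, KNPreFKG.connFamily o₀ x with h𝒬
  have h𝒬up : IsUpperSet 𝒬 := by
    intro C C' hle hC
    obtain ⟨x, hx, hCx⟩ := mem_iUnion₂.1 hC
    exact mem_iUnion₂.2 ⟨x, hx, KNPreFKG.isUpperSet_connFamily o₀ x hle hCx⟩
  set Q : Set (BondConfig (Fin n)) := {ω | openEdgeCluster ω o₀ ∈ 𝒬} with hQ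
  have hQeq : Q = ⋃ x ∈ A, (openConn o₀ x : Set (BondConfig (Fin n))) := by
    ext ω
    simp only [hQ, h𝒬, mem_setOf_eq, mem_iUnion]
    constructor
    · rintro ⟨x, hx, hωx⟩
      refine ⟨x, hx, ?_⟩
      rw [KNPreFKG.openConn_eq_setOf_connFamily]; exact hωx
    · rintro ⟨x, hx, hωx⟩
      refine ⟨x, hx, ?_⟩
      rw [KNPreFKG.openConn_eq_setOf_connFamily] at hωx; exact hωx
  -- Kozma–Nitzan Lemma 3(i)
  have key := KozmaNitzan2024_lemma3_i g a o₀ b hδ hdom h𝒬up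
  change (prodBernoulli g).real (openConn a b ∩ Q) ≤
    (prodBernoulli g).real (openConn o₀ b ∩ Q) + δ * (prodBernoulli g).real Q at key
  -- transfer between `o₀`-events and `O`-events on the conull event `K`
  have hUA : ∀ ω, ω ∈ K →
      (ω ∈ (⋃ o ∈ O, ⋃ x ∈ A, openConn o x : Set (BondConfig (Fin n))) ↔
        ω ∈ (⋃ x ∈ A, openConn o₀ x : Set (BondConfig (Fin n)))) := by
    intro ω hωK
    simp only [mem_iUnion]
    constructor
    · rintro ⟨o, ho, x, hx, hox⟩
      exact ⟨x, hx, (reachable_of_mem_block hωK ho₀ ho).trans hox⟩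
    · rintro ⟨x, hx, hox⟩
      exact ⟨o₀, ho₀, x, hx, hox⟩
  have hUb : ∀ ω, ω ∈ K →
      (ω ∈ (⋃ o ∈ O, openConn o b : Set (BondConfig (Fin n))) ↔
        ω ∈ (openConn o₀ b : Set (BondConfig (Fin n)))) := by
    intro ω hωK
    simp only [mem_iUnion]
    constructor
    · rintro ⟨o, ho, hob⟩
      exact (reachable_of_mem_block hωK ho₀ ho).trans hob
    · intro hob
      exact ⟨o₀, ho₀, hob⟩
  have e1 : (prodBernoulli g).real (openConn a b ∩ ⋃ o ∈ O, ⋃ x ∈ A, openConn o x) =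
      (prodBernoulli g).real (openConn a b ∩ Q) := by
    rw [hQeq]
    exact sigmaRec_inter_congr g hKc (fun ω _ hωK => hUA ω hωK)
  have e2 : (prodBernoulli g).real (⋃ o ∈ O, ⋃ x ∈ A, openConn o x) = (prodBernoulli g).real Q := by
    rw [hQeq]
    have := sigmaRec_inter_congr g (L := univ) hKc (fun ω _ hωK => hUA ω hωK)
    simpa only [univ_inter] using this
  have e3 : (prodBernoulli g).real (⋃ o ∈ O, openConn o b) = (prodBernoulli g).real (openConn o₀ b) := by
    have := sigmaRec_inter_congr g (L := univ) hKc (fun ω _ hωK => hUb ω hωK)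
    simpa only [univ_inter] using this
  rw [e1, e2, e3]
  have hmono : (prodBernoulli g).real (openConn o₀ b ∩ Q) ≤ (prodBernoulli g).real (openConn o₀ b) :=
    measureReal_mono inter_subset_left (measure_ne_top _ _)
  linarith

/-- **Question 9 for a glued block at least as reliable as the anchor.**  For any finset `O ∋ o₀`, any `A`, `a`, `b`:
if `μ_{glue_O w}(a ↔ b) ≤ μ_{glue_O w}(o₀ ↔ b)` then `μ_{glue_O w}(a ↔ b, O ↔ A) ≤ μ_{glue_O w}(O ↔ b)` — the
conclusion of `blockThm4_witness` / `blockQ9_step` from a single comparison of the anchor with the GLUED block. [this work; cite: KozmaNitzan2024, Lemma 3(i) (pp. 6–7), Question 9 (p. 36)] -/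
theorem blockQ9_of_reliableBlock (w : Sym2 (Fin n) → unitInterval) (O A : Finset (Fin n)) (a b o₀ : Fin n)
    (ho₀ : o₀ ∈ O)
    (hdom : (prodBernoulli (fun e : Sym2 (Fin n) => if (∀ x ∈ e, x ∈ O) ∧ ¬ e.IsDiag then 1 else w e)).real
        (openConn a b) ≤
      (prodBernoulli (fun e : Sym2 (Fin n) => if (∀ x ∈ e, x ∈ O) ∧ ¬ e.IsDiag then 1 else w e)).real
        (openConn o₀ b)) :
    (prodBernoulli (fun e : Sym2 (Fin n) => if (∀ x ∈ e, x ∈ O) ∧ ¬ e.IsDiag then 1 else w e)).real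
        (openConn a b ∩ ⋃ o ∈ O, ⋃ x ∈ A, openConn o x) ≤
      (prodBernoulli (fun e : Sym2 (Fin n) => if (∀ x ∈ e, x ∈ O) ∧ ¬ e.IsDiag then 1 else w e)).real
        (⋃ o ∈ O, openConn o b) := by
  have h := blockQ9_of_reliableBlock_slack w O A a b o₀ ho₀ le_rfl (by simpa using hdom)
  simpa using h

/-- **Additive gluing for a block at least as reliable as the anchor (up to slack `δ`).**
`μ_{glue_O w}(O ↔ A) − μ_{glue_O w}(O ↔ b) ≤ μ_{glue_O w}(O ↔ A, a ↮ b) + δ · μ_{glue_O w}(O ↔ A)`; the first term on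
the right is at most `μ_{glue_O w}(a ↮ b)`. [this work; cite: KozmaNitzan2024, Lemma 3(i) (pp. 6–7)] -/
theorem blockGluing_of_reliableBlock (w : Sym2 (Fin n) → unitInterval) (O A : Finset (Fin n)) (a b o₀ : Fin n)
    (ho₀ : o₀ ∈ O) {δ : ℝ} (hδ : 0 ≤ δ)
    (hdom : (prodBernoulli (fun e : Sym2 (Fin n) => if (∀ x ∈ e, x ∈ O) ∧ ¬ e.IsDiag then 1 else w e)).real
        (openConn a b) ≤
      (prodBernoulli (fun e : Sym2 (Fin n) => if (∀ x ∈ e, x ∈ O) ∧ ¬ e.IsDiag then 1 else w e)).real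
        (openConn o₀ b) + δ) :
    (prodBernoulli (fun e : Sym2 (Fin n) => if (∀ x ∈ e, x ∈ O) ∧ ¬ e.IsDiag then 1 else w e)).real
        (⋃ o ∈ O, ⋃ x ∈ A, openConn o x) -
      (prodBernoulli (fun e : Sym2 (Fin n) => if (∀ x ∈ e, x ∈ O) ∧ ¬ e.IsDiag then 1 else w e)).real
        (⋃ o ∈ O, openConn o b) ≤
      (prodBernoulli (fun e : Sym2 (Fin n) => if (∀ x ∈ e, x ∈ O) ∧ ¬ e.IsDiag then 1 else w e)).real
        ((⋃ o ∈ O, ⋃ x ∈ A, openConn o x) ∩ (openConn a b)ᶜ) +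
      δ * (prodBernoulli (fun e : Sym2 (Fin n) => if (∀ x ∈ e, x ∈ O) ∧ ¬ e.IsDiag then 1 else w e)).real
        (⋃ o ∈ O, ⋃ x ∈ A, openConn o x) := by
  set μ := prodBernoulli (fun e : Sym2 (Fin n) => if (∀ x ∈ e, x ∈ O) ∧ ¬ e.IsDiag then 1 else w e) with hμ
  set U : Set (BondConfig (Fin n)) := ⋃ o ∈ O, ⋃ x ∈ A, openConn o x with hU
  have h := blockQ9_of_reliableBlock_slack w O A a b o₀ ho₀ hδ hdom
  have hsplit : μ.real U = μ.real (U ∩ openConn a b) + μ.real (U ∩ (openConn a b)ᶜ) := by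
    rw [← measureReal_inter_add_sdiff (s := U) (MeasurableSet.of_discrete : MeasurableSet (openConn a b))
      (measure_ne_top _ _), Set.sdiff_eq]
  rw [inter_comm] at h
  change μ.real (U ∩ openConn a b) ≤ μ.real (⋃ o ∈ O, openConn o b) + δ * μ.real U at h
  linarith [hsplit]

end BlockQ9

end

end Summit.CriticalPhenomena.PercolationContinuityZ3.Theorems
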